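/-
Copyright (c) 2026 the pub-hodgecm-mathlib formalisation cell (harness21).  Prover seat hodgecm-mathlib-LH6-p04 (g11), 2026-09-03.  E1 item (U7) «GEODESIC INCLUSION»
(E1 keeper ∕ dealer F0P3a-p03 (g29) 01:19:21Z; ledger v5 rows 39α–δ), FILE β «UNITARY GAUSS ON THE APARTMENT» (over ★ FILE α `UnitaryLatticeTreeWeightedGauss` (LH6-p04) and
★ row 39β-gen `UnitaryGaussFactorsDescend` (LH5-p05 (g11))).
-/
import Literature.NumberTheory.Automorphic.UnitaryLatticeTreeWeightedGauss    -- ★ FILE α (LH6-p04 g11): level token on `latt (diagonal d)` entrywise, weighted LDU at `N = 3`, monotone transfer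
import Literature.NumberTheory.Automorphic.UnitaryGaussFactorsDescend          -- ★ row 39β-gen (LH5-p05 g11): `UnitaryGroup.unitary_of_ldu_blockTriangular` (LDU factors of a unitary matrix are unitary)
import Literature.NumberTheory.Automorphic.UnitaryLatticeTreeApartmentPath     -- ★ the standard apartment `L_a`, `L′_a`; brings `v_uniformizer_zpow`, `uniformizer_ne_zero`
import HarnessLib

/-!
# The lattice graph of a hermitian space — UNITARY GAUSS ON THE APARTMENT: the weighted Iwahori factorisation INSIDE `U(σ, Φ₃)` at level `c` on a diagonal lattice, and
# (U7) ON THE STANDARD APARTMENT: `U_{A(j)} ⊆ U_{A(i)} · U_{A(k)}` for `i ≤ j ≤ k` ([SS97] Prop. I.2.7 + Prop. I.3.1, lattice model)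

Topic `NumberTheory/Automorphic`; namespace `Literature.NumberTheory.Automorphic.UnitaryLatticeTree` (T1a currency of ★ `UnitaryLatticeTreeDefs`).  THEOREMS ONLY (no definition,
no instance, no notation, no named fact, no `sorry`); kernel lane.  Cell `pub/hodgecm-mathlib` (D-0151), crux H413 = `stmt-HodgeConjecture-24833`; E1 item (U7) (keeper
F0P3a-p03 (g29)), file β of four (α ★ `UnitaryLatticeTreeWeightedGauss`; β-gen ★ `UnitaryGaussFactorsDescend` (LH5-p05); γ `UnitaryLatticeTreeGeodesicApartment` (F0P3a-p01); δ the
row-34 `hU7` HEAD).  HONEST LABEL: count-neutral generic base layer of the (R-SS) resolution engine (census E1 v1 §1–§2); (R-SS) NOT chartered; HC_CM is proved only modulo the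
2 remaining named inputs (hLiu418 24832, h413 24833) until rung 0 closes; nothing printed is asserted here.

THE MATHEMATICS.  `K` a field with `Valued K ℤᵐ⁰`, `σ : K →+* K`, `Φ₃ = antidiag(1,1,1)`, `U(σ, Φ₃) ≤ GL₃(K)` (★ `unitaryGroupOfForm`).  The UNITARY LEVEL GROUP of a lattice `M` at
level `c` is written hypothesis-style (rows 22∕22b): `g ∈ U_M ↔ g ∈ U(σ,Φ₃) ∧ g·M = M ∧ (g − 1)·M ⊆ c·M`.
* §1 **WEIGHTED IWAHORI FACTORISATION INSIDE `U(σ, Φ₃)`**: for `g ∈ U(σ, Φ₃)` with the weighted bound `|(g − 1)_{ij}|·|d_j| ≤ |c|·|d_i|` (`|c| < 1`; = `(g − 1)·latt (diagonal d)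
  ⊆ c·latt (diagonal d)`, ★ α §1) there are `L, D, U ∈ U(σ, Φ₃)`, lower unitriangular ∕ diagonal ∕ upper unitriangular, `g = L·D·U`, each with the SAME weighted bound (★ α §4
  gives the matrices, ★ β-gen `unitary_of_ldu_blockTriangular` their unitarity, `GL` packaging by `mkOfDetNeZero`).
* §2 **THREE DIAGONAL LATTICES IN MONOTONE POSITION**: if `d₂` sits «between» `d₁` and `d₃` in the sense of ★ α §5 (`hlow`: `E₃ − E₂` non-increasing, `hup`: `E₁ − E₂`
  non-decreasing), then `U_{latt diag d₂} ⊆ U_{latt diag d₃} · U_{latt diag d₁}` and `⊆ U_{latt diag d₁} · U_{latt diag d₃}` (factor `g = (L·D)·U`, move `L·D` to `d₃` and `U` to `d₁`;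
  the other order by inversion).
* §3 **THE STANDARD APARTMENT** `A(j) = latt diag(ϖ^{⌊(j+1)/2⌋}, 1, ϖ^{−⌊j/2⌋})` (`j : ℤ`; `A(2a) = L_a`, `A(2a+1) = L′_{a+1}` of ★ `UnitaryLatticeTreeApartmentPath`): the exponent steps are
  `(1,0,0)` and `(0,0,−1)`, so `i ≤ j ≤ k` puts `A(j)` between `A(i)` and `A(k)` and **`U_{A(j)} ⊆ U_{A(i)} · U_{A(k)}`, `U_{A(j)} ⊆ U_{A(k)} · U_{A(i)}`** — (U7) of
  [SS97 Prop. I.3.1] on the standard apartment of the `U(3)` tree, every level `0 < |c| < 1`.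

## References
* [SchneiderStuhler1997] P. Schneider, U. Stuhler, *Representation theory and sheaves on the Bruhat–Tits building*, Publ. Math. IHÉS 85 (1997): Ch. I Prop. I.2.7
  (Iwahori factorisation of `U_F^{(e)}`), Prop. I.3.1 p. 118 (`U_z^{(e)} ⊆ U_x^{(e)} U_{x′}^{(e)}` for `z ∈ [x, x′]`).
* [BruhatTits1972] F. Bruhat, J. Tits, *Groupes réductifs sur un corps local* I, Publ. Math. IHÉS 41 (1972): §10 (lattice model), (7.4.18).
* [Rogawski1990] J. D. Rogawski, *Automorphic Representations of Unitary Groups in Three Variables* (1990): §1.9–§1.10 pp. 8–9.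
* [Serre1980Trees] J.-P. Serre, *Trees* (1980): Ch. II §1.1–1.2.
-/

set_option autoImplicit false

noncomputable section

open scoped Valued WithZero Matrix MatrixGroups Pointwise

namespace Literature.NumberTheory.Automorphic.UnitaryLatticeTree

open Literature.NumberTheory.Automorphic Literature.NumberTheory.Automorphic.HermitianLattice Literature.NumberTheory.Automorphic.UnitaryGroup
open Literature.NumberTheory.Automorphic.CartanUnique (uniformizer_ne_zero v_uniformizer_zpow)

variable {K : Type*} [Field K] [Valued K ℤᵐ⁰] (σ : K →+* K) {N : ℕ}

/-! ## §1 Weighted Iwahori factorisation inside `U(σ, Φ₃)` -/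

omit [Valued K ℤᵐ⁰] in
/-- A lower unitriangular matrix has determinant `1`. [cite: Rogawski1990, §1.10 p. 9] -/
theorem det_eq_one_of_lower_unitriangular {A : Matrix (Fin N) (Fin N) K} (hA : A.BlockTriangular OrderDual.toDual) (h1 : ∀ i, A i i = 1) : A.det = 1 := by
  rw [Matrix.det_of_lowerTriangular A hA]
  exact Finset.prod_eq_one fun i _ => h1 i

omit [Valued K ℤᵐ⁰] in
/-- An upper unitriangular matrix has determinant `1`. [cite: Rogawski1990, §1.10 p. 9] -/
theorem det_eq_one_of_upper_unitriangular {A : Matrix (Fin N) (Fin N) K} (hA : A.BlockTriangular _root_.id) (h1 : ∀ i, A i i = 1) : A.det = 1 := by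
  rw [Matrix.det_of_upperTriangular hA]
  exact Finset.prod_eq_one fun i _ => h1 i

omit [Valued K ℤᵐ⁰] in
/-- A matrix with zero off-diagonal entries has determinant `∏ A_{ii}`, non-zero when the diagonal entries are. [cite: Rogawski1990, §1.10 p. 9] -/
theorem det_ne_zero_of_offDiag_eq_zero {A : Matrix (Fin N) (Fin N) K} (hA : ∀ i j, i ≠ j → A i j = 0) (h0 : ∀ i, A i i ≠ 0) : A.det ≠ 0 := by
  have hup : A.BlockTriangular _root_.id := fun i j hij => hA i j (ne_of_gt hij)
  rw [Matrix.det_of_upperTriangular hup]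
  exact Finset.prod_ne_zero_iff.2 fun i _ => h0 i

omit [Valued K ℤᵐ⁰] in
/-- A `GL` element with prescribed matrix `diagonal d` (`d_i ≠ 0`). [cite: Serre1980Trees, Ch. II §1.1] -/
theorem exists_gl_coe_eq_diagonal {d : Fin N → K} (hd : ∀ i, d i ≠ 0) : ∃ γ : GL (Fin N) K, (γ : Matrix (Fin N) (Fin N) K) = Matrix.diagonal d := by
  have hdet : (Matrix.diagonal d).det ≠ 0 := by rw [Matrix.det_diagonal]; exact Finset.prod_ne_zero_iff.2 fun i _ => hd i
  exact ⟨Matrix.GeneralLinearGroup.mkOfDetNeZero _ hdet, rfl⟩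

/-- **WEIGHTED IWAHORI FACTORISATION INSIDE `U(σ, Φ₃)`**: for `g ∈ U(σ, Φ₃)(K)` whose matrix has the weighted bound `|(g − 1)_{ij}|·|d_j| ≤ |c|·|d_i|` (`|c| < 1`, `d_i ≠ 0`;
= `(g − 1)·latt (diagonal d) ⊆ c·latt (diagonal d)`, ★ FILE α §1) there are `L, D, U ∈ U(σ, Φ₃)(K)` with `g = L·D·U`, `L` lower unitriangular, `D` diagonal, `U` upper
unitriangular, and the SAME weighted bound on `L − 1`, `D − 1`, `U − 1` (★ α `exists_weighted_ldu_three` + ★ β-gen `unitary_of_ldu_blockTriangular`).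
[cite: SchneiderStuhler1997, Ch. I Prop. I.2.7] [cite: BruhatTits1972, §10] [cite: Rogawski1990, §1.10 p. 9] -/
theorem exists_unitary_weighted_ldu_three {c : K} (hc1 : Valued.v c < 1) {d : Fin 3 → K} (hd : ∀ i, d i ≠ 0) {g : GL (Fin 3) K}
    (hgU : g ∈ unitaryGroupOfForm σ ((StdForm.antidiagonal 3).over K))
    (hg : ∀ i j, Valued.v (((g : Matrix (Fin 3) (Fin 3) K) - 1) i j) * Valued.v (d j) ≤ Valued.v c * Valued.v (d i)) :
    ∃ L D U : GL (Fin 3) K, g = L * D * U ∧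
      L ∈ unitaryGroupOfForm σ ((StdForm.antidiagonal 3).over K) ∧ D ∈ unitaryGroupOfForm σ ((StdForm.antidiagonal 3).over K) ∧
      U ∈ unitaryGroupOfForm σ ((StdForm.antidiagonal 3).over K) ∧
      (L : Matrix (Fin 3) (Fin 3) K).BlockTriangular OrderDual.toDual ∧ (∀ i, (L : Matrix (Fin 3) (Fin 3) K) i i = 1) ∧
      (∀ i j, i ≠ j → (D : Matrix (Fin 3) (Fin 3) K) i j = 0) ∧
      (U : Matrix (Fin 3) (Fin 3) K).BlockTriangular _root_.id ∧ (∀ i, (U : Matrix (Fin 3) (Fin 3) K) i i = 1) ∧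
      (∀ i j, Valued.v (((L : Matrix (Fin 3) (Fin 3) K) - 1) i j) * Valued.v (d j) ≤ Valued.v c * Valued.v (d i)) ∧
      (∀ i j, Valued.v (((D : Matrix (Fin 3) (Fin 3) K) - 1) i j) * Valued.v (d j) ≤ Valued.v c * Valued.v (d i)) ∧
      (∀ i j, Valued.v (((U : Matrix (Fin 3) (Fin 3) K) - 1) i j) * Valued.v (d j) ≤ Valued.v c * Valued.v (d i)) := by
  obtain ⟨L, D, U, hprod, hL, hL1, hD, hU, hU1, hbL, hbD, hbU⟩ := exists_weighted_ldu_three hc1 hd (g : Matrix (Fin 3) (Fin 3) K) hg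
  -- unitarity of the three matrix factors (★ β-gen)
  obtain ⟨hLu, hDu, hUu⟩ := unitary_of_ldu_blockTriangular (σ := σ) (mem_unitaryGroupOfForm_iff.1 hgU) hprod ⟨hL, hL1⟩ hD ⟨hU, hU1⟩
  -- the diagonal entries of `D` are `1`-units, hence non-zero
  have hD0 : ∀ i, D i i ≠ 0 := by
    intro i h0
    have h1 : Valued.v ((D - 1) i i) ≤ Valued.v c := v_apply_diag_le_of_weighted hd hbD i
    rw [Matrix.sub_apply, Matrix.one_apply_eq, h0, zero_sub, Valuation.map_neg, Valuation.map_one] at h1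
    exact not_lt.2 h1 hc1
  -- `GL` packaging
  have hdetL : L.det ≠ 0 := by rw [det_eq_one_of_lower_unitriangular hL hL1]; exact one_ne_zero
  have hdetU : U.det ≠ 0 := by rw [det_eq_one_of_upper_unitriangular hU hU1]; exact one_ne_zero
  have hdetD : D.det ≠ 0 := det_ne_zero_of_offDiag_eq_zero hD hD0
  refine ⟨Matrix.GeneralLinearGroup.mkOfDetNeZero L hdetL, Matrix.GeneralLinearGroup.mkOfDetNeZero D hdetD, Matrix.GeneralLinearGroup.mkOfDetNeZero U hdetU,
    ?_, mem_unitaryGroupOfForm_iff.2 hLu, mem_unitaryGroupOfForm_iff.2 hDu, mem_unitaryGroupOfForm_iff.2 hUu, hL, hL1, hD, hU, hU1, hbL, hbD, hbU⟩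
  exact Units.ext hprod

/-! ## §2 Three diagonal lattices in monotone position: `U_{d₂} ⊆ U_{d₃} · U_{d₁}` and `U_{d₂} ⊆ U_{d₁} · U_{d₃}` -/

/-- Membership in the unitary level group of `latt (diagonal d)` from the weighted bound: unitary + weighted bound ⇒ member (the stabiliser clause is automatic at level
`0 < |c| < 1`, ★ row 22 `mapGL_latt_eq_of_map_sub_one_le_scaleLattice`). [cite: SchneiderStuhler1997, Ch. I §2 (U1)] -/
theorem mem_unitaryLevel_latt_diagonal_of_weighted {c : K} (hc0 : c ≠ 0) (hc1 : Valued.v c < 1) {d : Fin N → K} (hd : ∀ i, d i ≠ 0)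
    {U₀ : Subgroup (GL (Fin N) K)}
    (hU₀ : ∀ g : GL (Fin N) K, g ∈ U₀ ↔ g ∈ unitaryGroupOfForm σ ((StdForm.antidiagonal N).over K) ∧ mapGL g (latt (Matrix.diagonal d)) = latt (Matrix.diagonal d) ∧
      (latt (Matrix.diagonal d)).map ((Matrix.toLin' ((g : Matrix (Fin N) (Fin N) K) - 1)).restrictScalars 𝒪[K]) ≤ scaleLattice c (latt (Matrix.diagonal d)))
    {g : GL (Fin N) K} (hgU : g ∈ unitaryGroupOfForm σ ((StdForm.antidiagonal N).over K))
    (hw : ∀ i j, Valued.v (((g : Matrix (Fin N) (Fin N) K) - 1) i j) * Valued.v (d j) ≤ Valued.v c * Valued.v (d i)) : g ∈ U₀ := by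
  have hlev := (latt_diagonal_map_le_scaleLattice_iff hd hc0 ((g : Matrix (Fin N) (Fin N) K) - 1)).2 hw
  obtain ⟨γ, hγ⟩ := exists_gl_coe_eq_diagonal hd
  refine (hU₀ g).2 ⟨hgU, ?_, hlev⟩
  rw [← hγ] at hlev ⊢
  exact mapGL_latt_eq_of_map_sub_one_le_scaleLattice hc0 hc1 g γ hlev

/-- **THREE DIAGONAL LATTICES IN MONOTONE POSITION**: let `d₁, d₂, d₃ : Fin 3 → Kˣ`-valued weights with `d₂` «between» `d₁` and `d₃` (`hlow`: `|d₃_s|·|d₂_r| ≤ |d₂_s|·|d₃_r|` for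
`s ≤ r`; `hup`: `|d₁_s|·|d₂_r| ≤ |d₂_s|·|d₁_r|` for `r ≤ s`).  Then the unitary level groups at level `c` (`0 < |c| < 1`) satisfy
`U_{latt diag d₂} ⊆ U_{latt diag d₃} · U_{latt diag d₁}` and `U_{latt diag d₂} ⊆ U_{latt diag d₁} · U_{latt diag d₃}`: factor `g = (L·D)·U` (§1), move `L·D` forward (★ α lower∕diagonal
transfer) and `U` backward (★ α upper transfer); the second inclusion by inversion. [cite: SchneiderStuhler1997, Ch. I Prop. I.3.1 p. 118] [cite: BruhatTits1972, §10] -/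
theorem unitaryLevel_subset_mul_of_between {c : K} (hc0 : c ≠ 0) (hc1 : Valued.v c < 1) {d₁ d₂ d₃ : Fin 3 → K} (h₁ : ∀ i, d₁ i ≠ 0) (h₂ : ∀ i, d₂ i ≠ 0) (h₃ : ∀ i, d₃ i ≠ 0)
    (hlow : ∀ r s : Fin 3, s ≤ r → Valued.v (d₃ s) * Valued.v (d₂ r) ≤ Valued.v (d₂ s) * Valued.v (d₃ r))
    (hup : ∀ r s : Fin 3, r ≤ s → Valued.v (d₁ s) * Valued.v (d₂ r) ≤ Valued.v (d₂ s) * Valued.v (d₁ r))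
    {U₁ U₂ U₃ : Subgroup (GL (Fin 3) K)}
    (hU₁ : ∀ g : GL (Fin 3) K, g ∈ U₁ ↔ g ∈ unitaryGroupOfForm σ ((StdForm.antidiagonal 3).over K) ∧ mapGL g (latt (Matrix.diagonal d₁)) = latt (Matrix.diagonal d₁) ∧
      (latt (Matrix.diagonal d₁)).map ((Matrix.toLin' ((g : Matrix (Fin 3) (Fin 3) K) - 1)).restrictScalars 𝒪[K]) ≤ scaleLattice c (latt (Matrix.diagonal d₁)))
    (hU₂ : ∀ g : GL (Fin 3) K, g ∈ U₂ ↔ g ∈ unitaryGroupOfForm σ ((StdForm.antidiagonal 3).over K) ∧ mapGL g (latt (Matrix.diagonal d₂)) = latt (Matrix.diagonal d₂) ∧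
      (latt (Matrix.diagonal d₂)).map ((Matrix.toLin' ((g : Matrix (Fin 3) (Fin 3) K) - 1)).restrictScalars 𝒪[K]) ≤ scaleLattice c (latt (Matrix.diagonal d₂)))
    (hU₃ : ∀ g : GL (Fin 3) K, g ∈ U₃ ↔ g ∈ unitaryGroupOfForm σ ((StdForm.antidiagonal 3).over K) ∧ mapGL g (latt (Matrix.diagonal d₃)) = latt (Matrix.diagonal d₃) ∧
      (latt (Matrix.diagonal d₃)).map ((Matrix.toLin' ((g : Matrix (Fin 3) (Fin 3) K) - 1)).restrictScalars 𝒪[K]) ≤ scaleLattice c (latt (Matrix.diagonal d₃))) :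
    (U₂ : Set (GL (Fin 3) K)) ⊆ (U₃ : Set (GL (Fin 3) K)) * (U₁ : Set (GL (Fin 3) K)) ∧
      (U₂ : Set (GL (Fin 3) K)) ⊆ (U₁ : Set (GL (Fin 3) K)) * (U₃ : Set (GL (Fin 3) K)) := by
  -- the forward inclusion
  have hfwd : (U₂ : Set (GL (Fin 3) K)) ⊆ (U₃ : Set (GL (Fin 3) K)) * (U₁ : Set (GL (Fin 3) K)) := by
    intro g hg
    obtain ⟨hgU, -, hlev⟩ := (hU₂ g).1 hg
    have hw := (latt_diagonal_map_le_scaleLattice_iff h₂ hc0 ((g : Matrix (Fin 3) (Fin 3) K) - 1)).1 hlev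
    obtain ⟨L, D, U, hprod, hLU, hDU, hUU, hL, hL1, hD, hU, -, hbL, hbD, hbU⟩ := exists_unitary_weighted_ldu_three σ hc1 h₂ hgU hw
    -- shapes of `L − 1`, `D − 1`, `U − 1`
    have hLs : ((L : Matrix (Fin 3) (Fin 3) K) - 1).BlockTriangular OrderDual.toDual := hL.sub Matrix.blockTriangular_one
    have hUs : ((U : Matrix (Fin 3) (Fin 3) K) - 1).BlockTriangular _root_.id := hU.sub Matrix.blockTriangular_one
    have hDs : ∀ i j, i ≠ j → ((D : Matrix (Fin 3) (Fin 3) K) - 1) i j = 0 := fun i j hij => by rw [Matrix.sub_apply, hD i j hij, Matrix.one_apply_ne hij, sub_zero]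
    -- transfer
    have hL3 := weighted_transfer_lower hLs h₂ hbL (fun i j hji => hlow i j hji)
    have hD3 := weighted_transfer_diagonal hDs h₂ hbD d₃
    have hU1 := weighted_transfer_upper hUs h₂ hbU (fun i j hij => hup i j hij)
    have hLm : L ∈ U₃ := mem_unitaryLevel_latt_diagonal_of_weighted σ hc0 hc1 h₃ hU₃ hLU hL3
    have hDm : D ∈ U₃ := mem_unitaryLevel_latt_diagonal_of_weighted σ hc0 hc1 h₃ hU₃ hDU hD3
    have hUm : U ∈ U₁ := mem_unitaryLevel_latt_diagonal_of_weighted σ hc0 hc1 h₁ hU₁ hUU hU1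
    rw [hprod]
    exact Set.mul_mem_mul (Subgroup.mul_mem _ hLm hDm) hUm
  refine ⟨hfwd, fun g hg => ?_⟩
  -- the backward inclusion by inversion
  obtain ⟨a, ha, b, hb, hab⟩ := Set.mem_mul.1 (hfwd (Subgroup.inv_mem U₂ hg))
  refine Set.mem_mul.2 ⟨b⁻¹, Subgroup.inv_mem U₁ hb, a⁻¹, Subgroup.inv_mem U₃ ha, ?_⟩
  rw [← _root_.mul_inv_rev, hab, inv_inv]

/-! ## §3 (U7) on the standard apartment `A(j) = latt diag(ϖ^{⌊(j+1)/2⌋}, 1, ϖ^{−⌊j/2⌋})` -/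

/-- The entries of the apartment weight vector are non-zero. [cite: Serre1980Trees, Ch. II §1.1] -/
theorem apartmentWeight_ne_zero {ϖ : K} (hϖ : Valued.v ϖ = WithZero.exp (-1 : ℤ)) (j : ℤ) :
    ∀ t : Fin 3, (![ϖ ^ ((j + 1) / 2), (1 : K), ϖ ^ (-(j / 2))] : Fin 3 → K) t ≠ 0 := by
  have hϖ0 := uniformizer_ne_zero hϖ
  intro t
  fin_cases t
  · exact zpow_ne_zero _ hϖ0
  · exact one_ne_zero
  · exact zpow_ne_zero _ hϖ0

/-- The valuations of the apartment weights as exponentials: `|ϖ^{⌊(j+1)/2⌋}| = exp(−⌊(j+1)/2⌋)`, `|1| = exp 0`, `|ϖ^{−⌊j/2⌋}| = exp(⌊j/2⌋)`. [cite: Serre1980Trees, Ch. II §1.1] -/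
theorem v_apartmentWeight {ϖ : K} (hϖ : Valued.v ϖ = WithZero.exp (-1 : ℤ)) (j : ℤ) :
    ∀ t : Fin 3, Valued.v ((![ϖ ^ ((j + 1) / 2), (1 : K), ϖ ^ (-(j / 2))] : Fin 3 → K) t) = WithZero.exp ((![-((j + 1) / 2), 0, j / 2] : Fin 3 → ℤ) t) := by
  intro t
  fin_cases t
  · exact v_uniformizer_zpow hϖ _
  · change Valued.v (1 : K) = WithZero.exp 0
    rw [Valuation.map_one, WithZero.exp_zero]
  · change Valued.v (ϖ ^ (-(j / 2))) = WithZero.exp (j / 2)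
    rw [v_uniformizer_zpow hϖ, neg_neg]

/-- **FORWARD MONOTONICITY along the apartment** (`j ≤ k`): the weights of `A(k)` against those of `A(j)` satisfy the lower-transfer condition of ★ α §5 — the exponent
difference `E(k) − E(j)` is non-increasing in the coordinate (steps `(1,0,0)` and `(0,0,−1)`). [cite: SchneiderStuhler1997, Ch. I Prop. I.3.1 p. 118] [cite: BruhatTits1972, §10] -/
theorem apartmentWeight_lower_mono {ϖ : K} (hϖ : Valued.v ϖ = WithZero.exp (-1 : ℤ)) {j k : ℤ} (hjk : j ≤ k) :
    ∀ r s : Fin 3, s ≤ r →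
      Valued.v ((![ϖ ^ ((k + 1) / 2), (1 : K), ϖ ^ (-(k / 2))] : Fin 3 → K) s) * Valued.v ((![ϖ ^ ((j + 1) / 2), (1 : K), ϖ ^ (-(j / 2))] : Fin 3 → K) r) ≤
        Valued.v ((![ϖ ^ ((j + 1) / 2), (1 : K), ϖ ^ (-(j / 2))] : Fin 3 → K) s) * Valued.v ((![ϖ ^ ((k + 1) / 2), (1 : K), ϖ ^ (-(k / 2))] : Fin 3 → K) r) := by
  intro r s hsr
  rw [v_apartmentWeight hϖ k s, v_apartmentWeight hϖ j r, v_apartmentWeight hϖ j s, v_apartmentWeight hϖ k r, ← WithZero.exp_add, ← WithZero.exp_add, WithZero.exp_le_exp]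
  fin_cases r <;> fin_cases s <;> simp at hsr ⊢ <;> omega

/-- **BACKWARD MONOTONICITY along the apartment** (`i ≤ j`): the weights of `A(i)` against those of `A(j)` satisfy the upper-transfer condition of ★ α §5.
[cite: SchneiderStuhler1997, Ch. I Prop. I.3.1 p. 118] [cite: BruhatTits1972, §10] -/
theorem apartmentWeight_upper_mono {ϖ : K} (hϖ : Valued.v ϖ = WithZero.exp (-1 : ℤ)) {i j : ℤ} (hij : i ≤ j) :
    ∀ r s : Fin 3, r ≤ s →
      Valued.v ((![ϖ ^ ((i + 1) / 2), (1 : K), ϖ ^ (-(i / 2))] : Fin 3 → K) s) * Valued.v ((![ϖ ^ ((j + 1) / 2), (1 : K), ϖ ^ (-(j / 2))] : Fin 3 → K) r) ≤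
        Valued.v ((![ϖ ^ ((j + 1) / 2), (1 : K), ϖ ^ (-(j / 2))] : Fin 3 → K) s) * Valued.v ((![ϖ ^ ((i + 1) / 2), (1 : K), ϖ ^ (-(i / 2))] : Fin 3 → K) r) := by
  intro r s hrs
  rw [v_apartmentWeight hϖ i s, v_apartmentWeight hϖ j r, v_apartmentWeight hϖ j s, v_apartmentWeight hϖ i r, ← WithZero.exp_add, ← WithZero.exp_add, WithZero.exp_le_exp]
  fin_cases r <;> fin_cases s <;> simp at hrs ⊢ <;> omega

/-- **(U7) ON THE STANDARD APARTMENT OF THE `U(3)` TREE** ([SS97] Prop. I.3.1 for `x, z, x′` on the standard apartment): for the unitary level groups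
`U_j = {g ∈ U(σ, Φ₃) : g·A(j) = A(j), (g − 1)·A(j) ⊆ c·A(j)}` (hypothesis-style; `A(j) = latt diag(ϖ^{⌊(j+1)/2⌋}, 1, ϖ^{−⌊j/2⌋})`, `0 < |c| < 1`) and `i ≤ j ≤ k`:
`U_j ⊆ U_i · U_k` and `U_j ⊆ U_k · U_i`. [cite: SchneiderStuhler1997, Ch. I Prop. I.3.1 p. 118] [cite: BruhatTits1972, §10] -/
theorem unitaryLevel_apartment_subset_mul {ϖ : K} (hϖ : Valued.v ϖ = WithZero.exp (-1 : ℤ)) {c : K} (hc0 : c ≠ 0) (hc1 : Valued.v c < 1)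
    (U : ℤ → Subgroup (GL (Fin 3) K))
    (hU : ∀ (m : ℤ) (g : GL (Fin 3) K), g ∈ U m ↔ g ∈ unitaryGroupOfForm σ ((StdForm.antidiagonal 3).over K) ∧
      mapGL g (latt (Matrix.diagonal ![ϖ ^ ((m + 1) / 2), (1 : K), ϖ ^ (-(m / 2))])) = latt (Matrix.diagonal ![ϖ ^ ((m + 1) / 2), (1 : K), ϖ ^ (-(m / 2))]) ∧
      (latt (Matrix.diagonal ![ϖ ^ ((m + 1) / 2), (1 : K), ϖ ^ (-(m / 2))])).map ((Matrix.toLin' ((g : Matrix (Fin 3) (Fin 3) K) - 1)).restrictScalars 𝒪[K]) ≤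
        scaleLattice c (latt (Matrix.diagonal ![ϖ ^ ((m + 1) / 2), (1 : K), ϖ ^ (-(m / 2))])))
    {i j k : ℤ} (hij : i ≤ j) (hjk : j ≤ k) :
    (U j : Set (GL (Fin 3) K)) ⊆ (U i : Set (GL (Fin 3) K)) * (U k : Set (GL (Fin 3) K)) ∧
      (U j : Set (GL (Fin 3) K)) ⊆ (U k : Set (GL (Fin 3) K)) * (U i : Set (GL (Fin 3) K)) := by
  obtain ⟨h31, h13⟩ := unitaryLevel_subset_mul_of_between σ hc0 hc1 (apartmentWeight_ne_zero hϖ i) (apartmentWeight_ne_zero hϖ j) (apartmentWeight_ne_zero hϖ k)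
    (apartmentWeight_lower_mono hϖ hjk) (apartmentWeight_upper_mono hϖ hij) (hU i) (hU j) (hU k)
  exact ⟨h13, h31⟩

end Literature.NumberTheory.Automorphic.UnitaryLatticeTree

end
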